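import Summits.ValiantsHypothesis.ValiantsHypothesis.Theorems.SymPencilPerFourColSix
import Summits.ValiantsHypothesis.ValiantsHypothesis.Theorems.SymPencilPerFourCrossSixTransport

/-!
# Route `SymPencil` — the column-space exclusion for the whole `S₄ × S₄ × ⟨ᵀ⟩`-orbit of `W_col`
# (`--supports` stmt-ValiantsHypothesis-5674 `SdcSuperquadratic`; cell `(10,6,6)` of the
# size-`27` kernel-package table; rung currency only, nothing here bears on `VP ≠ VNP`)

`SymPencilPerFourColSix.false_of_ker_eq_colW` excludes the kernel space
`W_col = rows{0,1} × cols{1,2,3}` in NORMALISED position.  Moving the PACKAGE along a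
`per_4`-semi-invariant automorphism `Φ` (`SymPencilPerFourCrossSixTransport.package_transport`)
gives the exclusion for `Φ (W_col)` (`false_of_ker_eq_colW_map`), in particular for every
`rows{r,r'} × (cols ∖ {c})` (`…_prodCongr`) and every transposed one `(rows ∖ {r}) × cols{c,c'}`
(`…_transpose_prodCongr`).  Unlike the cross space, no determinant constancy is needed, so the
statements hold over any field of characteristic `0`.  No definitions, no named facts. [folklore]
-/

noncomputable section

-- single-conjunct layout: Sub = Summit, duplicated namespace component intended
set_option linter.dupNamespace false

namespace Summit.ValiantsHypothesis.ValiantsHypothesis.Theorems.SymPencilPerFourColSixTransport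

open Matrix MvPolynomial Module
open Literature.Computability.AlgebraicComplexity
open Summit.ValiantsHypothesis.ValiantsHypothesis.Theorems.SymPencilPerFourColSix
open Summit.ValiantsHypothesis.ValiantsHypothesis.Theorems.SymPencilPerFourCrossSixTransport
open Summit.ValiantsHypothesis.ValiantsHypothesis.Theorems.SymPencilPerFourBlocks
open Summit.ValiantsHypothesis.ValiantsHypothesis.Theorems.SymPencilPerFourTwoRowsRadical

universe u

variable {k : Type u} [Field k] [CharZero k] {ι' : Type*} [Fintype ι'] [DecidableEq ι']

/-- **`Φ (W_col)` is not a kernel space** (package form): if `Φ` is a `per_4`-semi-invariant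
linear automorphism (`per_4 (Φ z) = χ per_4 (z)`, `χ ≠ 0`) and the kernel space of the package
is `Φ (W_col)`, i.e. `bL x = 0 ↔ Φ⁻¹ x ∈ W_col`, then `False` (`|ι'| ≤ 26`, `dim (im bL) ≥ 10`).
[folklore] -/
theorem false_of_ker_eq_colW_map {D : Matrix ι' ι' k} (hD : IsUnit D.det) (hDs : Dᵀ = D)
    (bL : (Fin 4 × Fin 4 → k) →ₗ[k] (ι' → k)) (CL : (Fin 4 × Fin 4 → k) →ₗ[k] Matrix ι' ι' k)
    (hCs : ∀ z, (CL z)ᵀ = CL z) {κ : k} (hκ : κ ≠ 0)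
    (hi : ∀ z, bL z ⬝ᵥ D⁻¹ *ᵥ bL z = 0)
    (hii : ∀ z, bL z ⬝ᵥ (D⁻¹ * CL z * D⁻¹) *ᵥ bL z = 0)
    (hN : ∀ v, bL v = 0 → IsUnit (D + CL v).det ∧ ∀ (z : Fin 4 × Fin 4 → k) (s : k),
      κ * MvPolynomial.eval (v + s • z) (perPoly (Fin 4) k) =
        (Matrix.fromBlocks ((s * 0) • (1 : Matrix Unit Unit k))
          (Matrix.replicateRow Unit (s • bL z)) (Matrix.replicateCol Unit (s • bL z))
          (D + CL v + s • CL z)).det)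
    (Φ : (Fin 4 × Fin 4 → k) ≃ₗ[k] (Fin 4 × Fin 4 → k)) (χ : k) (hχ : χ ≠ 0)
    (hΦ : ∀ z, MvPolynomial.eval (Φ z) (perPoly (Fin 4) k) =
      χ * MvPolynomial.eval z (perPoly (Fin 4) k))
    (hker : ∀ x : Fin 4 × Fin 4 → k,
      bL x = 0 ↔ ∀ z : Fin 4 × Fin 4, ¬ ((z.1 = 0 ∨ z.1 = 1) ∧ z.2 ≠ 0) → Φ.symm x z = 0)
    (h10 : 10 ≤ finrank k (LinearMap.range bL)) (hcard : Fintype.card ι' ≤ 26) : False := by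
  have hN' := package_transport bL CL hN Φ χ hΦ
  refine false_of_ker_eq_colW hD hDs (bL ∘ₗ Φ.toLinearMap) (CL ∘ₗ Φ.toLinearMap)
    (fun z => hCs _) (mul_ne_zero hχ hκ) (fun z => hi _) (fun z => hii _) hN' (fun x => ?_) ?_
    hcard
  · rw [LinearMap.comp_apply, hker]
    simp
  · rw [LinearMap.range_comp_of_range_eq_top _ Φ.range]
    exact h10

/-- **Row/column permutations**: if `bL x = 0 ↔ (x ∘ (σ × τ)) ∈ W_col` (i.e. the kernel space
is `rows{σ 0, σ 1} × cols{τ 1, τ 2, τ 3}`) then `False`. [folklore] -/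
theorem false_of_ker_eq_colW_prodCongr {D : Matrix ι' ι' k} (hD : IsUnit D.det) (hDs : Dᵀ = D)
    (bL : (Fin 4 × Fin 4 → k) →ₗ[k] (ι' → k)) (CL : (Fin 4 × Fin 4 → k) →ₗ[k] Matrix ι' ι' k)
    (hCs : ∀ z, (CL z)ᵀ = CL z) {κ : k} (hκ : κ ≠ 0)
    (hi : ∀ z, bL z ⬝ᵥ D⁻¹ *ᵥ bL z = 0)
    (hii : ∀ z, bL z ⬝ᵥ (D⁻¹ * CL z * D⁻¹) *ᵥ bL z = 0)
    (hN : ∀ v, bL v = 0 → IsUnit (D + CL v).det ∧ ∀ (z : Fin 4 × Fin 4 → k) (s : k),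
      κ * MvPolynomial.eval (v + s • z) (perPoly (Fin 4) k) =
        (Matrix.fromBlocks ((s * 0) • (1 : Matrix Unit Unit k))
          (Matrix.replicateRow Unit (s • bL z)) (Matrix.replicateCol Unit (s • bL z))
          (D + CL v + s • CL z)).det)
    (σ τ : Equiv.Perm (Fin 4))
    (hker : ∀ x : Fin 4 × Fin 4 → k,
      bL x = 0 ↔ ∀ z : Fin 4 × Fin 4, ¬ ((z.1 = 0 ∨ z.1 = 1) ∧ z.2 ≠ 0) →
        x ((Equiv.prodCongr σ τ) z) = 0)
    (h10 : 10 ≤ finrank k (LinearMap.range bL)) (hcard : Fintype.card ι' ≤ 26) : False := by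
  have hΦs : ∀ z : Fin 4 × Fin 4 → k,
      (LinearEquiv.funCongrLeft k k (Equiv.prodCongr σ τ)).symm z =
        z ∘ (Equiv.prodCongr σ.symm τ.symm) := by
    intro z
    ext p
    simp [LinearEquiv.funCongrLeft_symm, LinearEquiv.funCongrLeft_apply]
  refine false_of_ker_eq_colW_map hD hDs bL CL hCs hκ hi hii hN
    (LinearEquiv.funCongrLeft k k (Equiv.prodCongr σ τ)).symm 1 one_ne_zero (fun z => ?_)
    (fun x => ?_) h10 hcard
  · rw [one_mul, hΦs]
    exact eval_perPoly_comp_prodCongr σ.symm τ.symm z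
  · rw [hker x, LinearEquiv.symm_symm]
    simp only [LinearEquiv.funCongrLeft_apply, LinearMap.funLeft_apply]

/-- **Transposed column spaces**: if `bL x = 0 ↔ (z ↦ x (τ z.2, σ z.1)) ∈ W_col` (kernel space
`= rows{τ 1, τ 2, τ 3} × cols{σ 0, σ 1}`), then `False`. [folklore] -/
theorem false_of_ker_eq_colW_transpose_prodCongr {D : Matrix ι' ι' k} (hD : IsUnit D.det)
    (hDs : Dᵀ = D)
    (bL : (Fin 4 × Fin 4 → k) →ₗ[k] (ι' → k)) (CL : (Fin 4 × Fin 4 → k) →ₗ[k] Matrix ι' ι' k)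
    (hCs : ∀ z, (CL z)ᵀ = CL z) {κ : k} (hκ : κ ≠ 0)
    (hi : ∀ z, bL z ⬝ᵥ D⁻¹ *ᵥ bL z = 0)
    (hii : ∀ z, bL z ⬝ᵥ (D⁻¹ * CL z * D⁻¹) *ᵥ bL z = 0)
    (hN : ∀ v, bL v = 0 → IsUnit (D + CL v).det ∧ ∀ (z : Fin 4 × Fin 4 → k) (s : k),
      κ * MvPolynomial.eval (v + s • z) (perPoly (Fin 4) k) =
        (Matrix.fromBlocks ((s * 0) • (1 : Matrix Unit Unit k))
          (Matrix.replicateRow Unit (s • bL z)) (Matrix.replicateCol Unit (s • bL z))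
          (D + CL v + s • CL z)).det)
    (σ τ : Equiv.Perm (Fin 4))
    (hker : ∀ x : Fin 4 × Fin 4 → k,
      bL x = 0 ↔ ∀ z : Fin 4 × Fin 4, ¬ ((z.1 = 0 ∨ z.1 = 1) ∧ z.2 ≠ 0) →
        x (τ z.2, σ z.1) = 0)
    (h10 : 10 ≤ finrank k (LinearMap.range bL)) (hcard : Fintype.card ι' ≤ 26) : False := by
  -- `Φ.symm x = z ↦ x (τ z.2, σ z.1)`, i.e. `Φ.symm = funCongrLeft (prodCongr σ τ ∘ prodComm)`
  set e : Fin 4 × Fin 4 ≃ Fin 4 × Fin 4 :=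
    (Equiv.prodComm (Fin 4) (Fin 4)).trans (Equiv.prodCongr τ σ) with he
  have he_apply : ∀ z : Fin 4 × Fin 4, e z = (τ z.2, σ z.1) := fun z => by
    obtain ⟨i, j⟩ := z
    rfl
  have hΦs : ∀ z : Fin 4 × Fin 4 → k,
      (LinearEquiv.funCongrLeft k k e).symm z = z ∘ e.symm := by
    intro z
    ext p
    simp [LinearEquiv.funCongrLeft_symm, LinearEquiv.funCongrLeft_apply]
  have hinv : ∀ z : Fin 4 × Fin 4 → k,
      MvPolynomial.eval (z ∘ e.symm) (perPoly (Fin 4) k) =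
        MvPolynomial.eval z (perPoly (Fin 4) k) := by
    intro z
    have h1 : z ∘ e.symm = LinearEquiv.funCongrLeft k k (Equiv.prodComm (Fin 4) (Fin 4))
        (z ∘ (Equiv.prodCongr σ.symm τ.symm)) := by
      ext p
      obtain ⟨i, j⟩ := p
      simp [he, LinearEquiv.funCongrLeft_apply, Equiv.prodCongr_apply]
    rw [h1, eval_perPoly_transpose, eval_perPoly_comp_prodCongr]
  refine false_of_ker_eq_colW_map hD hDs bL CL hCs hκ hi hii hN
    (LinearEquiv.funCongrLeft k k e).symm 1 one_ne_zero (fun z => ?_) (fun x => ?_) h10 hcard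
  · rw [one_mul, hΦs]
    exact hinv z
  · rw [hker x, LinearEquiv.symm_symm]
    simp only [LinearEquiv.funCongrLeft_apply, LinearMap.funLeft_apply, he_apply]

end Summit.ValiantsHypothesis.ValiantsHypothesis.Theorems.SymPencilPerFourColSixTransport

end
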